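import Summits.QuantumAdvantage.AdviceFreeQNC0.M19SegmentCounter
import HarnessLib

/-!
# M19 part 3: the general form expansion `form_expansion` (engine of Theorems A and B)

PROVENANCE / PORT (ask P2-19a): authored by the planner seat qa-qnc0-p2 g19 (`HOME/qa-qnc0-p2/line19/M19Proofs.lean`, 1542 lines,
farm rc 0 / 0 sorry / 0 warnings), ported by qn-prover-3 g12 as six files `M19Linearisation` → `M19SegmentCounter` →
`M19FormExpansion` → `M19IntervalLoss` → `M19AffineTests` → `M19StepForms`; everything is placed in the namespace
`Summit.QuantumAdvantage.AdviceFreeQNC0.M19` (so `M19.winCount` / `M19.lossCount` do not shadow the cell's `AffBells22.winCount`),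
28 one-line docstrings were added, nothing else changed.  Separation NOT moved.
-/

/-! ## General form expansion — the common engine for Theorems B (interval counters) and A (affine tests)

A cut reading `K` affine forms `φ_j(u) = β_j + Σ_i u_i L_{j,i}` over `ZMod p` through an arbitrary table `f_g` has
`1_WIN = Σ_{(g, r, c⃗, b)} formC · Π_i (u_i ? formρ_i : 1)` with letters `formρ_i = ψ(Σ_j c_j L_{j,i}) · η^{(b+1)(1+[i<g])}`:
every letter lies in the alphabet `μ_p · {η, η²}` and none is `1`. -/

section FormExp

namespace Summit.QuantumAdvantage.AdviceFreeQNC0.M19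

open Finset

variable {F : Type} [Field F]

/-- An additive character of a finite sum is the product of the character values. -/
theorem addChar_map_sum {R : Type} [CommRing R] (ψ : AddChar R F) {ι : Type} [DecidableEq ι]
    (s : Finset ι) (z : ι → R) : ψ (∑ i ∈ s, z i) = ∏ i ∈ s, ψ (z i) := by
  induction s using Finset.induction_on with
  | empty => simp
  | insert a s ha ih => rw [Finset.sum_insert ha, Finset.prod_insert ha, AddChar.map_add_eq_mul, ih]

/-- An additive character of a Boolean-gated sum is the Boolean-gated product. -/
theorem addChar_sum_boolIte {R : Type} [CommRing R] (ψ : AddChar R F) {n : ℕ} (u : Fin n → Bool) (z : Fin n → R) :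
    ψ (∑ i, (if u i = true then z i else 0)) = ∏ i, (if u i = true then ψ (z i) else 1) := by
  classical
  rw [addChar_map_sum]
  refine Finset.prod_congr rfl (fun i _ => ?_)
  split_ifs
  · rfl
  · exact AddChar.map_zero_eq_one ψ

/-- two-factor rearrangement. -/
theorem sum2_factor {α β : Type} [Fintype α] [Fintype β] (K : F) (a : α → F) (b : β → F) :
    ∑ x : α × β, K * (a x.1 * b x.2) = K * ((∑ i, a i) * (∑ j, b j)) := by
  rw [Fintype.sum_prod_type, Finset.sum_mul_sum, Finset.mul_sum]
  refine Finset.sum_congr rfl (fun i _ => ?_)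
  rw [Finset.mul_sum]

variable {p : ℕ} [NeZero p] (ψ : AddChar (ZMod p) F) (η : F)

/-- coefficient of the term `(g, r, c⃗, b)` for the tables `f` and offsets `β`. -/
def formC {n K : ℕ} (c : ℕ) (f : Fin (n + 1) → (Fin K → ZMod p) → Bool) (β : Fin (n + 1) → Fin K → ZMod p)
    (g : Fin (n + 1)) (r cv : Fin K → ZMod p) (b : Fin 2) : F :=
  (if f g r = true then 1 else 0) * (∏ j, ψ (cv j * (β g j - r j))) * η ^ ((b.val + 1) * (c + g.val))

/-- letter of the term `(g, c⃗, b)` at coordinate `i` for the coefficient system `L`. -/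
def formρ {n K : ℕ} (L : Fin (n + 1) → Fin K → Fin n → ZMod p)
    (g : Fin (n + 1)) (cv : Fin K → ZMod p) (b : Fin 2) (i : Fin n) : F :=
  ψ (∑ j, cv j * L g j i) * ((if i.val < g.val then η ^ (b.val + 1) else 1) * η ^ (b.val + 1))

/-- **Form expansion.** -/
theorem form_expansion [CharP F 2] (hη3 : η ^ 3 = 1) (hη1 : η ≠ 1) (hp : Odd p) {ξ : F} (hξ : IsPrimitiveRoot ξ p)
    (hψ : ∀ z : ZMod p, ψ z = ξ ^ z.val)
    {n K : ℕ} (c : ℕ) (y : Fin (n + 1) → (Fin n → Bool) → Bool)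
    (L : Fin (n + 1) → Fin K → Fin n → ZMod p) (β : Fin (n + 1) → Fin K → ZMod p)
    (f : Fin (n + 1) → (Fin K → ZMod p) → Bool)
    (hf : ∀ g u, y g u = f g (fun j => β g j + ∑ i, (if u i = true then L g j i else 0)))
    (u : Fin n → Bool) :
    (if ringWinU c y u = true then (1 : F) else 0)
      = ∑ t : Fin (n + 1) × (Fin K → ZMod p) × (Fin K → ZMod p) × Fin 2,
          formC ψ η c f β t.1 t.2.1 t.2.2.1 t.2.2.2
            * ∏ i : Fin n, (if u i = true then formρ ψ η L t.1 t.2.2.1 t.2.2.2 i else 1) := by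
  classical
  rw [linearisationIdentity F η hη3 hη1 n c y u, Fintype.sum_prod_type]
  refine Finset.sum_congr rfl (fun g _ => ?_)
  -- indicator of one residue as a character sum
  have hind : ∀ x : ZMod p, (if x = 0 then (1 : F) else 0) = ∑ c' : ZMod p, ψ (c' * x) := by
    intro x
    rw [counterExpansion F p hp ξ hξ x]
    exact Finset.sum_congr rfl (fun c' _ => by rw [hψ])
  -- the c⃗-sum collapses to the indicator `[φ = r]`
  have hcv : ∀ φ r : Fin K → ZMod p,
      ∑ cv : Fin K → ZMod p, (∏ j, ψ (cv j * (β g j - r j))) * ψ (∑ j, cv j * (φ j - β g j))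
        = if φ = r then 1 else 0 := by
    intro φ r
    have h1 : ∀ cv : Fin K → ZMod p,
        (∏ j, ψ (cv j * (β g j - r j))) * ψ (∑ j, cv j * (φ j - β g j)) = ∏ j, ψ (cv j * (φ j - r j)) := by
      intro cv
      rw [addChar_map_sum, ← Finset.prod_mul_distrib]
      refine Finset.prod_congr rfl (fun j _ => ?_)
      rw [← AddChar.map_add_eq_mul]
      congr 1
      ring
    simp_rw [h1]
    have h2 := Finset.prod_univ_sum (fun _ : Fin K => (Finset.univ : Finset (ZMod p)))
      (fun j c' => ψ (c' * (φ j - r j)))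
    rw [Fintype.piFinset_univ] at h2
    rw [← h2]
    simp_rw [← hind]
    by_cases hφr : φ = r
    · rw [if_pos hφr]
      refine Finset.prod_eq_one (fun j _ => ?_)
      rw [if_pos (by rw [hφr]; exact sub_self _)]
    · rw [if_neg hφr]
      have hex : ∃ j, φ j - r j ≠ 0 := by
        by_contra hall
        exact hφr (funext fun j => sub_eq_zero.mp (not_not.mp (not_exists.mp hall j)))
      obtain ⟨j, hj⟩ := hex
      exact Finset.prod_eq_zero (Finset.mem_univ j) (if_neg hj)
  -- the label part
  have hℓ : c + g.val + walkExp u g.val = c + g.val + wt u + wtPrefix u g.val := by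
    unfold walkExp; ring
  have hX : η ^ (c + g.val + walkExp u g.val) + η ^ (2 * (c + g.val + walkExp u g.val))
      = ∑ b : Fin 2, η ^ ((b.val + 1) * (c + g.val)) * ((η ^ (b.val + 1)) ^ wt u * (η ^ (b.val + 1)) ^ wtPrefix u g.val) := by
    rw [Fin.sum_univ_two, hℓ]
    simp only [Fin.val_zero, Fin.val_one, zero_add]
    rw [← pow_mul, ← pow_mul, ← pow_add, ← pow_add, ← pow_mul, ← pow_mul, ← pow_add, ← pow_add]
    congr 1 <;> ring_nf
  -- per-coordinate letters
  have key : ∀ (cv : Fin K → ZMod p) (b : Fin 2),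
      ∏ i : Fin n, (if u i = true then formρ ψ η L g cv b i else 1)
        = ψ (∑ i, (if u i = true then ∑ j, cv j * L g j i else 0))
            * ((η ^ (b.val + 1)) ^ wt u * (η ^ (b.val + 1)) ^ wtPrefix u g.val) := by
    intro cv b
    rw [addChar_sum_boolIte, pow_wt_eq_prod, pow_wtPrefix_eq_prod, prod_boolIte_mul, prod_boolIte_mul]
    refine Finset.prod_congr rfl (fun i _ => ?_)
    by_cases hu : u i = true
    · simp only [hu, if_true]
      unfold formρ
      split_ifs <;> ring
    · simp [hu]
  -- the form vector of `u`
  have hsum : ∀ cv : Fin K → ZMod p,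
      ∑ i, (if u i = true then ∑ j, cv j * L g j i else 0)
        = ∑ j, cv j * ((fun j => β g j + ∑ i, (if u i = true then L g j i else 0)) j - β g j) := by
    intro cv
    have : ∀ j, cv j * ((fun j => β g j + ∑ i, (if u i = true then L g j i else 0)) j - β g j)
        = ∑ i, (if u i = true then cv j * L g j i else 0) := by
      intro j
      simp only [add_sub_cancel_left, Finset.mul_sum]
      refine Finset.sum_congr rfl (fun i _ => ?_)
      split_ifs <;> simp
    simp_rw [this]
    rw [Finset.sum_comm]
    refine Finset.sum_congr rfl (fun i _ => ?_)
    split_ifs <;> simp_all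
  symm
  calc ∑ s : (Fin K → ZMod p) × (Fin K → ZMod p) × Fin 2,
        formC ψ η c f β g s.1 s.2.1 s.2.2 * ∏ i : Fin n, (if u i = true then formρ ψ η L g s.2.1 s.2.2 i else 1)
      = ∑ r : Fin K → ZMod p, (if f g r = true then (1 : F) else 0) *
          ((∑ cv : Fin K → ZMod p, (∏ j, ψ (cv j * (β g j - r j)))
              * ψ (∑ j, cv j * ((fun j => β g j + ∑ i, (if u i = true then L g j i else 0)) j - β g j))) *
           (∑ b : Fin 2, η ^ ((b.val + 1) * (c + g.val)) * ((η ^ (b.val + 1)) ^ wt u * (η ^ (b.val + 1)) ^ wtPrefix u g.val))) := by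
        rw [Fintype.sum_prod_type]
        refine Finset.sum_congr rfl (fun r _ => ?_)
        rw [← sum2_factor]
        refine Finset.sum_congr rfl (fun x _ => ?_)
        rw [key, hsum]
        unfold formC
        ring
    _ = ∑ r : Fin K → ZMod p, (if f g r = true then (1 : F) else 0) *
          ((if (fun j => β g j + ∑ i, (if u i = true then L g j i else 0)) = r then (1 : F) else 0) *
           (η ^ (c + g.val + walkExp u g.val) + η ^ (2 * (c + g.val + walkExp u g.val)))) := by
        refine Finset.sum_congr rfl (fun r _ => ?_)
        rw [hcv, hX]
    _ = (if f g (fun j => β g j + ∑ i, (if u i = true then L g j i else 0)) = true then (1 : F) else 0) *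
          (η ^ (c + g.val + walkExp u g.val) + η ^ (2 * (c + g.val + walkExp u g.val))) := by
        rw [Finset.sum_eq_single (fun j => β g j + ∑ i, (if u i = true then L g j i else 0))]
        · simp
        · intro r _ hr
          have : ¬ ((fun j => β g j + ∑ i, (if u i = true then L g j i else 0)) = r) := fun h => hr h.symm
          simp [this]
        · intro h; exact absurd (Finset.mem_univ _) h
    _ = (if y g u = true then
          η ^ (c + g.val + walkExp u g.val) + η ^ (2 * (c + g.val + walkExp u g.val)) else 0) := by
        rw [hf g u]
        split_ifs <;> simp

omit [NeZero p] in
/-- every form letter is `≠ 1`. -/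
theorem formρ_ne_one (hη : IsPrimitiveRoot η 3) (h3 : ¬ 3 ∣ p) (hψp : ∀ z : ZMod p, (ψ z) ^ p = 1)
    {n K : ℕ} (L : Fin (n + 1) → Fin K → Fin n → ZMod p) (g : Fin (n + 1)) (cv : Fin K → ZMod p) (b : Fin 2)
    (i : Fin n) : formρ ψ η L g cv b i ≠ 1 := by
  have hη3 := hη.pow_eq_one
  have hη4 : η ^ 4 = η := by
    calc η ^ 4 = η ^ 3 * η := by ring
      _ = η := by rw [hη3, one_mul]
  unfold formρ
  fin_cases b
  · by_cases h : i.val < g.val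
    · simp only [h, if_true, zero_add, pow_one]
      rw [show η * η = η ^ 2 by ring]
      exact psi_mul_eta_pow_ne_one ψ η hη h3 hψp _ 2 (Or.inr rfl)
    · simp only [h, if_false, zero_add, pow_one, one_mul]
      have := psi_mul_eta_pow_ne_one ψ η hη h3 hψp (∑ j, cv j * L g j i) 1 (Or.inl rfl)
      simpa using this
  · by_cases h : i.val < g.val
    · simp only [h, if_true]
      rw [show η ^ (1 + 1) * η ^ (1 + 1) = η ^ 4 by ring, hη4]
      have := psi_mul_eta_pow_ne_one ψ η hη h3 hψp (∑ j, cv j * L g j i) 1 (Or.inl rfl)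
      simpa using this
    · simp only [h, if_false, one_mul]
      exact psi_mul_eta_pow_ne_one ψ η hη h3 hψp _ 2 (Or.inr rfl)

end Summit.QuantumAdvantage.AdviceFreeQNC0.M19

end FormExp
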